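import Summits.Langlands.Langlands.Theses.GaloisWeightedBE
import Literature.NumberTheory.LFunctions.StarkNoQuadraticSubfieldProofs
import Literature.NumberTheory.LFunctions.AbelianFieldDedekindZeta
import Literature.NumberTheory.LFunctions.RHWave0GRHProofs
import Literature.NumberTheory.GaloisRepresentations.KroneckerWeberTheorem
import HarnessLib

/-!
# Line `artin_split` — crux #4 `ExtendedRiemannHypothesis` (stmt-Langlands-14565) of route GaloisWeightedBE:
# the FOUR LEAVES of the two-level decomposition (crux-strategist planner-cstrat-stmt-Langlands-14565-r1-0,
# 2026-08-17; RESTATED re-audit / BC2 redirect v2, requirement (d) "a registered plan for both pieces")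

Level 1 (registered line `kw_stark_seam`): `ExtendedRiemannHypothesis ⟸ GeneralizedRiemannHypothesis ∧
GaloisMultipleZerosOnLine` (Kronecker–Weber + the Stark seam, sorry-free). Level 2 (birth skeletons
`Lines/birth_GeneralizedRiemannHypothesis.lean`, `Lines/birth_GaloisMultipleZerosOnLine.lean`): each piece from
two leaves. This file is the self-contained composition (crux workfiles are not importable modules), so that the
four leaves are REGISTERED stubs of a line concluding the crux BY NAME:

* `stub_riemannHypothesis` (OPEN) — Mathlib's `RiemannHypothesis`, BY NAME (= the RH summit `Summit.RiemannHypothesis`);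
* `stub_grhNonprincipalPrimitive` (OPEN) — GRH (open strip) for every NON-PRINCIPAL PRIMITIVE Dirichlet character;
* `stub_nonlinearArtinOrderZero` (OPEN) — off the line in the open strip, `n(G,χ) = ord_s L(s, χ∘q) = 0` for every
  irreducible `χ` of degree `≥ 2` of a finite Galois quotient `q : Γ_ℚ → G`;
* `stub_linearArtinOrderSumLeOne` (OPEN) — off the line in the open strip, `Σ_{χ linear} n(G,χ) ≤ 1`.

Composition `ExtendedRiemannHypothesis_of : leaf₁ → leaf₂ → leaf₃ → leaf₄ → GaloisWeightedBE.ExtendedRiemannHypothesis`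
(REAL proof, sorry-free): leaves 1–2 ⇒ GRH (tree reduction to primitive characters + `L(s, 1 mod 1) = ζ`);
GRH ⇒ ERH(abelian fields) (Kronecker–Weber `KroneckerWeber_holds` + Washington Thm. 4.3, proved tree theorems);
leaves 3–4 ⇒ `GaloisMultipleZerosOnLine` (Heilbronn `ord_s ζ_N = θ_G(1) = Σ_χ χ(1) n(G,χ)`); then the Stark seam.
Every leaf is implied by the crux (ERH ⇒ all `n(G,χ) = 0` off the line, `sum_sq_artinOrder_le`), so the line is
exactly as safe as the crux. Sorries ONLY in `stub_*`.
-/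

noncomputable section

namespace Summit.Langlands.Langlands.Cruxes.ExtendedRiemannHypothesis.ArtinSplitLine

/-! ### The four leaves (registered stubs) -/

/-- **stub_riemannHypothesis** (OPEN): the Riemann Hypothesis, BY NAME — Mathlib's `RiemannHypothesis`
(`= Summit.RiemannHypothesis`, the RH summit; every non-trivial zero of `ζ` has real part `1/2`).
[cite: Bombieri2000, §I] -/
theorem stub_riemannHypothesis : RiemannHypothesis := by
  sorry

/-- **stub_grhNonprincipalPrimitive** (OPEN): GRH in the open strip for every non-principal primitive
Dirichlet character `χ` mod `N` (`χ.RiemannHypothesis`: `L(s,χ) = 0 → 0 < Re s < 1 → Re s = 1/2`).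
[cite: MontgomeryVaughan2007, §10.1] [cite: DavenportMNT1980, Ch. 20] -/
theorem stub_grhNonprincipalPrimitive : ∀ (N : ℕ) [NeZero N] (χ : DirichletCharacter ℂ N),
    χ.IsPrimitive → χ ≠ 1 → χ.RiemannHypothesis := by
  sorry

open Literature.NumberTheory.Automorphic Literature.NumberTheory.LFunctions
  Literature.NumberTheory.LFunctions.Heilbronn Literature.RepresentationTheory.FiniteGroups

/-- **stub_nonlinearArtinOrderZero** (OPEN): for a finite Galois quotient `q : Γ_ℚ → G` and `s` in the
open critical strip OFF the line `Re s = 1/2`, every irreducible character `χ` of `G` of degree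
`χ(1) ≠ 1` has `n(G, χ) = ord_s L(s, χ ∘ q) = 0` (no zero, no pole: GRH off the line together with
Artin's holomorphy conjecture off the line, for the non-abelian irreducible Artin `L`-functions
over `ℚ`). [cite: MurtyMurty1997, Ch. 2 §5–6] [cite: IwaniecKowalski2004, §5.13] -/
theorem stub_nonlinearArtinOrderZero : ∀ (G : Type) [Group G] [Fintype G]
    (q : Field.absoluteGaloisGroup ℚ →* G), IsArtinQuotient q → ∀ (s : ℂ), 0 < s.re → s.re < 1 →
    s.re ≠ 1 / 2 → ∀ χ : G → ℂ, IsIrrChar G χ → χ 1 ≠ 1 → artinOrder s (χ ∘ q) = 0 := by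
  sorry

/-- **stub_linearArtinOrderSumLeOne** (OPEN; implied by GRH for Dirichlet `L`-functions, not
conversely as far as is known): for a finite Galois quotient `q : Γ_ℚ → G` and `s` in the open
critical strip off the line, `Σ_{χ irreducible, χ(1) = 1} ord_s L(s, χ ∘ q) ≤ 1` — the degree-one
(`=` Dirichlet, by Artin reciprocity over `ℚ`) `L`-functions of `N` have, off the line, only simple
zeros, no two of them at the same point. [cite: DavenportMNT1980, Ch. 20] [cite: MurtyMurty1997, Ch. 2 §5] -/
theorem stub_linearArtinOrderSumLeOne : ∀ (G : Type) [Group G] [Fintype G]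
    (q : Field.absoluteGaloisGroup ℚ →* G), IsArtinQuotient q → ∀ (s : ℂ), 0 < s.re → s.re < 1 →
    s.re ≠ 1 / 2 →
    (∑ χ ∈ (irrChars_finite_holds G).toFinset with χ 1 = 1, artinOrder s (χ ∘ q)) ≤ 1 := by
  sorry

open scoped NumberField ComplexConjugate
open Complex Filter Topology NumberField IntermediateField
open Literature.NumberTheory.Automorphic Literature.NumberTheory.LFunctions
  Literature.NumberTheory.LFunctions.Heilbronn Literature.NumberTheory.LFunctions.NumberField
  Literature.NumberTheory.GaloisRepresentations Literature.RepresentationTheory.FiniteGroups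

attribute [local instance 1001] AlgebraicClosure.instAlgebra IntermediateField.algebra'
  IntermediateField.module'

/-- **ERH for abelian number fields** (auxiliary; PROVED below to be equivalent to the tree's named
conjecture `Literature.NumberTheory.LFunctions.GeneralizedRiemannHypothesis`, GRH for Dirichlet `L`-functions). -/
def AbelianERH : Prop :=
  ∀ (K : Type) [Field K] [NumberField K] [IsAbelianGalois ℚ K],
    Literature.NumberTheory.LFunctions.NumberField.ExtendedRiemannHypothesis K

/-- piece X₂ (sub-crux `GaloisMultipleZerosOnLine`): **multiple zeros of Galois Dedekind zeta functions lie
on the line** — for every number field `N` Galois over `ℚ` and every `s` with `0 < Re s < 1`, if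
`ζ_N(s) = 0` and `ζ_N'(s) = 0` then `Re s = 1/2`. -/
def GaloisMultipleZerosOnLine : Prop :=
  ∀ (N : Type) [Field N] [NumberField N] [IsGalois ℚ N] (s : ℂ), 0 < s.re → s.re < 1 →
    Literature.NumberTheory.LFunctions.dedekindZetaCont N s = 0 →
    deriv (Literature.NumberTheory.LFunctions.dedekindZetaCont N) s = 0 → s.re = 1 / 2


/-! ### Piece X₁ = GRH for Dirichlet `L`-functions: `AbelianERH ↔ GeneralizedRiemannHypothesis` (Kronecker–Weber) -/

/-- `IsAbelianGalois ℚ` is invariant under `ℚ`-algebra isomorphisms. [folklore] -/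
theorem isAbelianGalois_of_algEquiv {K K' : Type*} [Field K] [Field K'] [Algebra ℚ K]
    [Algebra ℚ K'] [h : IsAbelianGalois ℚ K] (e : K ≃ₐ[ℚ] K') : IsAbelianGalois ℚ K' := by
  haveI : IsGalois ℚ K' := IsGalois.of_algEquiv e
  have hcomm : ∀ a b : K' ≃ₐ[ℚ] K', a * b = b * a := by
    intro a b
    obtain ⟨a₀, rfl⟩ := e.autCongr.surjective a
    obtain ⟨b₀, rfl⟩ := e.autCongr.surjective b
    rw [← map_mul, ← map_mul, h.toIsMulCommutative.is_comm.comm a₀ b₀]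
  haveI : IsMulCommutative (K' ≃ₐ[ℚ] K') := ⟨⟨hcomm⟩⟩
  exact {}

/-- **GRH for Dirichlet `L`-functions ⇒ ERH for abelian number fields**: embed `K ↪ ℚ̄`; by
Kronecker–Weber (tree `KroneckerWeber_holds`) the image lies in `ℚ(μ_m)`; transport to the model
`CyclotomicField m ℚ` (`IsCyclotomicExtension.algEquiv`) and factor `ζ_F = ∏_{χ ∈ X(F)} L(s, χ⋆)`
(tree `AbelianDedekindZeta.dedekindZetaCont_eq_prod_characterGroup_LFunction`, Washington Thm. 4.3): a strip
zero of `ζ_K` is a zero of some primitive `L(s, χ⋆)`. [cite: Washington1997, Thm. 4.3 and Thm. 14.1] -/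
theorem abelianERH_of_generalizedRiemannHypothesis (hgrh : GeneralizedRiemannHypothesis) :
    AbelianERH := by
  intro K _ _ _ s hz hpos hlt
  classical
  have hs1 : s ≠ 1 := by
    intro h
    rw [h, one_re] at hlt
    exact lt_irrefl _ hlt
  -- embed `K ↪ ℚ̄`; its image `L₀` is a finite abelian subextension of `ℚ̄/ℚ`
  let Qb := AlgebraicClosure ℚ
  let f : K →ₐ[ℚ] Qb := IsAlgClosed.lift
  let L₀ : IntermediateField ℚ Qb := f.fieldRange
  have eK : K ≃ₐ[ℚ] L₀ := f.equivFieldRange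
  haveI : FiniteDimensional ℚ L₀ := LinearEquiv.finiteDimensional eK.toLinearEquiv
  haveI : IsAbelianGalois ℚ L₀ := isAbelianGalois_of_algEquiv eK
  -- Kronecker–Weber: `L₀ ⊆ ℚ(μ_m)`
  obtain ⟨m, hm, hle⟩ := KroneckerWeber_holds L₀ inferInstance inferInstance
  haveI : NeZero m := ⟨hm.ne'⟩
  -- `C = ℚ(μ_m) ⊆ ℚ̄` is an `m`-th cyclotomic extension of `ℚ`
  let C : IntermediateField ℚ Qb :=
    IntermediateField.adjoin ℚ {x : Qb | ∃ n ∈ ({m} : Set ℕ), n ≠ 0 ∧ x ^ n = 1}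
  haveI hC : IsCyclotomicExtension {m} ℚ C := by
    refine IntermediateField.isCyclotomicExtension_adjoin_of_exists_isPrimitiveRoot {m} ℚ Qb ?_
    intro n hn hn0
    haveI := IsSepClosedOfCharZero.isCyclotomicExtension (K := Qb) {n}
    exact IsCyclotomicExtension.exists_isPrimitiveRoot Qb Qb hn hn0
  have hle' : L₀ ≤ C := by
    refine hle.trans (IntermediateField.adjoin.mono ℚ _ _ ?_)
    intro x hx
    exact ⟨m, Set.mem_singleton m, hm.ne', hx⟩
  -- move everything to the model `L' = CyclotomicField m ℚ`
  let L' := CyclotomicField m ℚ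
  haveI : IsCyclotomicExtension {m} ℚ L' := CyclotomicField.isCyclotomicExtension m ℚ
  let e₁ : C ≃ₐ[ℚ] L' := IsCyclotomicExtension.algEquiv {m} ℚ C L'
  let g : K →ₐ[ℚ] L' := e₁.toAlgHom.comp ((IntermediateField.inclusion hle').comp eK.toAlgHom)
  let F : IntermediateField ℚ L' := g.fieldRange
  have eF : K ≃ₐ[ℚ] F := g.equivFieldRange
  -- `ζ_K(s) = ζ_F(s) = ∏_{χ ∈ X(F)} L(s, χ⋆)`
  have hF0 : dedekindZetaCont F s = 0 := by
    rw [dedekindZetaCont_eq_of_ringEquiv eF.symm.toRingEquiv hs1]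
    exact hz
  rw [AbelianDedekindZeta.dedekindZetaCont_eq_prod_characterGroup_LFunction (n := m) L' F hs1,
    Finset.prod_eq_zero_iff] at hF0
  obtain ⟨χ, -, hχ⟩ := hF0
  haveI : NeZero χ.conductor := ⟨χ.conductor_ne_zero⟩
  exact hgrh χ.conductor χ.primitiveCharacter s hχ hpos hlt

/-- **ERH for abelian number fields ⇒ GRH for Dirichlet `L`-functions**: a strip zero of `L(s, χ)`, `χ` mod `N`,
is a zero of `ζ_{ℚ(ζ_N)}` (tree `dedekindZetaCont_eq_zero_of_LFunction_eq_zero`), and `ℚ(ζ_N)/ℚ` is abelian.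
[cite: Washington1997, Thm. 4.3] -/
theorem generalizedRiemannHypothesis_of_abelianERH (h : AbelianERH) :
    GeneralizedRiemannHypothesis := by
  intro N _ χ s hs h0 h1
  have hs1 : s ≠ 1 := by
    intro h'
    rw [h', one_re] at h1
    exact lt_irrefl _ h1
  haveI : IsCyclotomicExtension {N} ℚ (CyclotomicField N ℚ) :=
    CyclotomicField.isCyclotomicExtension N ℚ
  have hz := dedekindZetaCont_eq_zero_of_LFunction_eq_zero N (CyclotomicField N ℚ) χ hs h0 hs1
  haveI : IsAbelianGalois ℚ (CyclotomicField N ℚ) :=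
    IsCyclotomicExtension.isAbelianGalois {N} ℚ (CyclotomicField N ℚ)
  exact h (CyclotomicField N ℚ) s hz h0 h1

/-- **`AbelianERH ↔ GeneralizedRiemannHypothesis`**: ERH for abelian number fields IS GRH for Dirichlet
`L`-functions (Kronecker–Weber both ways). [cite: Washington1997, Thm. 4.3 and Thm. 14.1] -/
theorem abelianERH_iff_generalizedRiemannHypothesis : AbelianERH ↔ GeneralizedRiemannHypothesis :=
  ⟨generalizedRiemannHypothesis_of_abelianERH, abelianERH_of_generalizedRiemannHypothesis⟩

/-! ### Piece X₁ from its leaves: GRH ⟸ RH ∧ GRH(non-principal primitive) -/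

/-- **Piece X₁ from its two leaves** (sorry-free): GRH for Dirichlet `L`-functions from RH (by name,
Mathlib `RiemannHypothesis` = the RH summit) and GRH for the NON-PRINCIPAL PRIMITIVE characters, through the
tree's reduction to primitive characters (`generalizedRiemannHypothesis_iff_isPrimitive`) and `L(s, 1 mod 1) = ζ`
(`riemannHypothesisStrip_iff_forall_dirichletCharacter_one`, `riemannHypothesis_iff_strip_holds`). [folklore] -/
theorem generalizedRiemannHypothesis_of :
    RiemannHypothesis →
    (∀ (N : ℕ) [NeZero N] (χ : DirichletCharacter ℂ N), χ.IsPrimitive → χ ≠ 1 → χ.RiemannHypothesis) →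
    Literature.NumberTheory.LFunctions.GeneralizedRiemannHypothesis := by
  intro hRH h
  refine generalizedRiemannHypothesis_iff_isPrimitive.mpr fun N _ χ hprim => ?_
  by_cases h1 : χ = 1
  · subst h1
    have hN : N = 1 :=
      (show (1 : DirichletCharacter ℂ N).conductor = N from hprim).symm.trans
        DirichletCharacter.conductor_one
    subst hN
    exact riemannHypothesisStrip_iff_forall_dirichletCharacter_one.mp
      (riemannHypothesis_iff_strip_holds.mp hRH) 1
  · exact h N χ hprim h1

/-! ### Piece X₂ from its leaves: Heilbronn's identity `ord_s ζ_N = Σ_χ χ(1) n(G,χ)` -/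

/-- A zero of `f` which is also a zero of `f'` is a zero of order `≥ 2` (Taylor). [folklore] -/
theorem two_le_meromorphicOrderAt {f : ℂ → ℂ} {s : ℂ} (hf : AnalyticAt ℂ f s) (hz : f s = 0)
    (hd : deriv f s = 0) : ((2 : ℤ) : WithTop ℤ) ≤ meromorphicOrderAt f s := by
  have h2 : ((2 : ℕ) : ℕ∞) ≤ analyticOrderAt f s := by
    rw [natCast_le_analyticOrderAt_iff_iteratedDeriv_eq_zero hf]
    intro i hi
    interval_cases i
    · simpa using hz
    · simpa using hd
  rw [hf.meromorphicOrderAt_eq]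
  cases h : analyticOrderAt f s with
  | top => simp
  | coe n =>
    rw [h] at h2
    have h2' : 2 ≤ n := by exact_mod_cast h2
    rw [ENat.map_coe]
    exact_mod_cast h2'

/-- **Piece X₂ from its two leaves** (sorry-free): `GaloisMultipleZerosOnLine` from the two leaf
statements, through Heilbronn's identity `ord_s ζ_N = θ_G(1) = Σ_χ χ(1) · n(G, χ)`. [folklore] -/
theorem GaloisMultipleZerosOnLine_of :
    (∀ (G : Type) [Group G] [Fintype G] (q : Field.absoluteGaloisGroup ℚ →* G), IsArtinQuotient q →
      ∀ (s : ℂ), 0 < s.re → s.re < 1 → s.re ≠ 1 / 2 →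
      ∀ χ : G → ℂ, IsIrrChar G χ → χ 1 ≠ 1 → artinOrder s (χ ∘ q) = 0) →
    (∀ (G : Type) [Group G] [Fintype G] (q : Field.absoluteGaloisGroup ℚ →* G), IsArtinQuotient q →
      ∀ (s : ℂ), 0 < s.re → s.re < 1 → s.re ≠ 1 / 2 →
      (∑ χ ∈ (irrChars_finite_holds G).toFinset with χ 1 = 1, artinOrder s (χ ∘ q)) ≤ 1) →
    GaloisMultipleZerosOnLine := by
  intro hNL hL N _ _ _ s hpos hlt hz hd
  classical
  by_contra hne
  have hs1 : s ≠ 1 := by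
    intro h
    rw [h, one_re] at hlt
    exact lt_irrefl _ hlt
  -- embed `N ↪ ℚ̄`; the image `N₀ = f(N)` is normal over `ℚ`; `q : Γ_ℚ → Gal(N₀/ℚ)`
  let L := AlgebraicClosure ℚ
  let f : N →ₐ[ℚ] L := IsAlgClosed.lift
  let N₀ : IntermediateField ℚ L := f.fieldRange
  have eN : N ≃ₐ[ℚ] N₀ := f.equivFieldRange
  haveI : Normal ℚ N₀ := Normal.of_algEquiv eN
  haveI : FiniteDimensional ℚ N₀ := LinearEquiv.finiteDimensional eN.toLinearEquiv
  obtain ⟨q, hq⟩ : ∃ q : Field.absoluteGaloisGroup ℚ →* (N₀ ≃ₐ[ℚ] N₀),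
      q = AlgEquiv.restrictNormalHom N₀ := ⟨_, rfl⟩
  have hqA : IsArtinQuotient q := isArtinQuotient_of_eq_restrictNormalHom hq
  haveI hNF : ∀ H', NumberField (quotientFixedField q H') :=
    fun H' => numberField_quotientFixedField hqA H'
  have hbot : quotientFixedField q ⊥ = N₀ := quotientFixedField_bot_of_eq_restrictNormalHom hq
  have e : quotientFixedField q (⊥ : Subgroup (N₀ ≃ₐ[ℚ] N₀)) ≃+* N :=
    ((IntermediateField.equivOfEq hbot).trans eN.symm).toRingEquiv
  -- `ord_s ζ_N ≥ 2`, i.e. `n(G, reg) ≥ 2`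
  set G := (N₀ ≃ₐ[ℚ] N₀) with hG
  have h2 : ((2 : ℤ) : WithTop ℤ) ≤ meromorphicOrderAt (dedekindZetaCont N) s :=
    two_le_meromorphicOrderAt (analyticAt_dedekindZetaCont hs1) hz hd
  have hreg : (artinOrder s ((Representation.leftRegular ℂ G).character ∘ q) : WithTop ℤ) =
      meromorphicOrderAt (dedekindZetaCont N) s := by
    rw [artinOrder_leftRegular hqA s, meromorphicOrderAt_dedekindZetaCont_eq_of_ringEquiv e hs1]
  have he2 : (2 : ℤ) ≤ artinOrder s ((Representation.leftRegular ℂ G).character ∘ q) := by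
    rw [← hreg] at h2
    exact_mod_cast h2
  -- Heilbronn: `n(G, reg) = θ_G(1) = Σ_χ n(G,χ) χ(1)`; the non-linear terms vanish (first stub)
  set T := (irrChars_finite_holds G).toFinset with hT
  have hmemT : ∀ {χ : G → ℂ}, χ ∈ T ↔ IsIrrChar G χ :=
    fun {χ} => (irrChars_finite_holds G).mem_toFinset
  have hθ1 : heilbronnChar q s 1 =
      (artinOrder s ((Representation.leftRegular ℂ G).character ∘ q) : ℂ) := heilbronnChar_one hqA s
  have hsum : heilbronnChar q s (1 : G) = ∑ χ ∈ T, (artinOrder s (χ ∘ q) : ℂ) * χ 1 :=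
    heilbronnChar_one_eq_sum (q := q) s
  have hsplit : (∑ χ ∈ T, (artinOrder s (χ ∘ q) : ℂ) * χ 1) =
      ∑ χ ∈ T with χ 1 = 1, (artinOrder s (χ ∘ q) : ℂ) := by
    rw [Finset.sum_filter]
    refine Finset.sum_congr rfl fun χ hχ => ?_
    by_cases h1 : χ 1 = 1
    · simp [h1]
    · have h0 : artinOrder s (χ ∘ q) = 0 := hNL G q hqA s hpos hlt hne χ (hmemT.mp hχ) h1
      simp [h0, h1]
  have hcast : (artinOrder s ((Representation.leftRegular ℂ G).character ∘ q) : ℂ) =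
      ((∑ χ ∈ T with χ 1 = 1, artinOrder s (χ ∘ q) : ℤ) : ℂ) := by
    rw [← hθ1, hsum, hsplit]
    push_cast
    rfl
  have heq : artinOrder s ((Representation.leftRegular ℂ G).character ∘ q) =
      ∑ χ ∈ T with χ 1 = 1, artinOrder s (χ ∘ q) := by exact_mod_cast hcast
  -- the linear terms sum to at most `1` (second stub): contradiction with `ord ≥ 2`
  have hle : (∑ χ ∈ T with χ 1 = 1, artinOrder s (χ ∘ q)) ≤ 1 := hL G q hqA s hpos hlt hne
  omega

/-! ### Transport of Galois predicates along the (unique) `ℚ`-algebra structure -/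

theorem isGalois_transport {N : Type*} [Field N] (i j : Algebra ℚ N) (h : @IsGalois ℚ _ N _ i) :
    @IsGalois ℚ _ N _ j := by
  have hij : i = j := Subsingleton.elim i j
  subst hij
  exact h

theorem isAbelianGalois_transport {N : Type*} [Field N] (i j : Algebra ℚ N)
    (h : @IsAbelianGalois ℚ N _ _ i) : @IsAbelianGalois ℚ N _ _ j := by
  have hij : i = j := Subsingleton.elim i j
  subst hij
  exact h

/-! ### A zero of order `≥ 2` of an analytic function kills the value and the derivative -/

theorem eq_zero_and_deriv_eq_zero_of_two_le {f : ℂ → ℂ} {s : ℂ} (hf : AnalyticAt ℂ f s)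
    (h2 : ((2 : ℤ) : WithTop ℤ) ≤ meromorphicOrderAt f s) : f s = 0 ∧ deriv f s = 0 := by
  have h2' : ((2 : ℕ) : ℕ∞) ≤ analyticOrderAt f s := by
    by_cases htop : analyticOrderAt f s = ⊤
    · rw [htop]; exact le_top
    · obtain ⟨n, hn⟩ := ENat.ne_top_iff_exists.mp htop
      rw [hf.meromorphicOrderAt_eq, ← hn, ENat.map_coe] at h2
      have h'' : (2 : ℤ) ≤ n := WithTop.coe_le_coe.mp h2
      rw [← hn]
      exact_mod_cast (show 2 ≤ n by omega)
  obtain ⟨g, hg, hfg⟩ := (natCast_le_analyticOrderAt hf).mp h2'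
  have hfg' : f =ᶠ[𝓝 s] fun z => (z - s) ^ 2 • g z := hfg
  have hfs : f s = 0 := by
    have h := hfg.self_of_nhds
    simpa using h
  refine ⟨hfs, ?_⟩
  rw [hfg'.deriv_eq]
  have hd := (((hasDerivAt_id' s).sub_const s).pow 2).smul hg.differentiableAt.hasDerivAt
  rw [show (fun z => (z - s) ^ 2 • g z) = ((fun x => x - s) ^ 2 • g) from rfl, hd.deriv]
  simp

/-! ### Heilbronn–Stark at a complex point: `θ_G = 0` or `θ_G` is a linear character -/

section Structure

variable {F : Type} [Field F] [NumberField F] {G : Type} [Group G] [Fintype G]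
  {q : Field.absoluteGaloisGroup F →* G}

/-- **Heilbronn–Stark structure theorem at an arbitrary point** `s₀ ≠ 1` with `ord_{s₀} ζ_N ≤ 1`
(`N` the field of `G`): Heilbronn's character is `0` or a character of degree one `χ₁ : G →* ℂˣ`
(Murty–Murty Ch. 2 Prop. 5.2: `Σ_χ n(G,χ)² ≤ n(G, reg)²`; Stark 1974 Thm. 3). The tree's
`heilbronnChar_eq_zero_or_eq_coe` is the real-point case with the extra conclusion `χ₁ = ±1`; the
realness is used there only for that extra conclusion, and the proof below is its verbatim prefix. -/
theorem heilbronnChar_eq_zero_or_eq_linear (hq : IsArtinQuotient q) {s₀ : ℂ} (hs₀ : s₀ ≠ 1)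
    (hle : artinOrder s₀ ((Representation.leftRegular ℂ G).character ∘ q) ≤ 1) :
    heilbronnChar q s₀ = 0 ∨
      ∃ χ₁ : G →* ℂˣ, heilbronnChar q s₀ = fun g => (χ₁ g : ℂ) := by
  classical
  set θ := heilbronnChar q s₀ with hθ
  set T := (irrChars_finite_holds G).toFinset with hT
  set n : (G → ℂ) → ℤ := fun χ => artinOrder s₀ (χ ∘ q) with hn
  set e : ℤ := artinOrder s₀ ((Representation.leftRegular ℂ G).character ∘ q) with he
  have hmemT : ∀ {χ : G → ℂ}, χ ∈ T ↔ IsIrrChar G χ := fun {χ} => (irrChars_finite_holds G).mem_toFinset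
  have hθ1 : θ 1 = (e : ℂ) := heilbronnChar_one hq s₀
  have hre : (θ 1).re = e := by rw [hθ1]; simp
  have hsq : (∑ χ ∈ T, n χ ^ 2 : ℤ) ≤ e ^ 2 := by
    have h := sum_sq_artinOrder_le hq hs₀ (G := G) (q := q)
    rw [hre] at h
    exact_mod_cast h
  have hθsum : θ = ∑ χ ∈ T, (n χ : ℂ) • χ := rfl
  have he0 : 0 ≤ e := by
    have h := norm_heilbronnChar_le hq hs₀ (1 : G)
    rw [hre] at h
    exact_mod_cast (norm_nonneg _).trans h
  rcases (show e = 0 ∨ e = 1 by omega) with he' | he'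
  · -- `e = 0`: all coefficients vanish
    left
    have hzero : ∀ χ ∈ T, n χ = 0 := fun χ hχ => by
      have h := (Finset.single_le_sum (fun χ' _ => sq_nonneg (n χ')) hχ).trans hsq
      rw [he'] at h
      exact pow_eq_zero_iff two_ne_zero |>.mp (le_antisymm (by simpa using h) (sq_nonneg _))
    rw [hθsum]
    exact Finset.sum_eq_zero fun χ hχ => by rw [hzero χ hχ]; simp
  · -- `e = 1`: exactly one coefficient, equal to `1`, at a character of degree `1`
    right
    have hS : ∀ χ ∈ T, ∀ χ' ∈ T, n χ ≠ 0 → n χ' ≠ 0 → χ = χ' := by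
      intro χ hχ χ' hχ' h0 h0'
      by_contra hne
      have h2 : n χ ^ 2 + n χ' ^ 2 ≤ ∑ ψ ∈ T, n ψ ^ 2 := by
        rw [← Finset.sum_pair (f := fun ψ => n ψ ^ 2) hne]
        exact Finset.sum_le_sum_of_subset_of_nonneg
          (by intro x hx; simp only [Finset.mem_insert, Finset.mem_singleton] at hx
              rcases hx with rfl | rfl <;> assumption)
          (fun ψ _ _ => sq_nonneg (n ψ))
      have h1 : 1 ≤ n χ ^ 2 := by nlinarith [sq_pos_of_ne_zero h0]
      have h1' : 1 ≤ n χ' ^ 2 := by nlinarith [sq_pos_of_ne_zero h0']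
      rw [he'] at hsq
      linarith
    have hex : ∃ χ₁ ∈ T, n χ₁ ≠ 0 := by
      by_contra hall
      push Not at hall
      have : θ 1 = 0 := by
        rw [hθsum, Finset.sum_apply]
        exact Finset.sum_eq_zero fun χ hχ => by simp [hall χ hχ]
      rw [hθ1, he'] at this
      simp at this
    obtain ⟨χ₁, hχ₁T, hn₁⟩ := hex
    have hχ₁ : IsIrrChar G χ₁ := hmemT.mp hχ₁T
    have hθχ : θ = (n χ₁ : ℂ) • χ₁ := by
      rw [hθsum]
      exact Finset.sum_eq_single χ₁ (fun χ hχ hne => by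
        have : n χ = 0 := by
          by_contra h0
          exact hne (hS χ hχ χ₁ hχ₁T h0 hn₁)
        simp [this]) (fun h => absurd hχ₁T h)
    have hterm_le : n χ₁ ^ 2 ≤ 1 := by
      have h := (Finset.single_le_sum (fun χ' _ => sq_nonneg (n χ')) hχ₁T).trans hsq
      rw [he'] at h
      simpa using h
    obtain ⟨d, hd, hd1⟩ := hχ₁.exists_apply_one_eq_natCast
    have hnd : (n χ₁ : ℂ) * d = 1 := by
      have := congrFun hθχ 1
      rw [Pi.smul_apply, smul_eq_mul, hd1, hθ1, he'] at this
      exact_mod_cast this.symm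
    have hnd' : n χ₁ * d = 1 := by exact_mod_cast hnd
    have hn1 : n χ₁ = 1 := by
      have hdpos : (0 : ℤ) < d := by exact_mod_cast hd
      nlinarith
    have hd1' : d = 1 := by
      rw [hn1, one_mul] at hnd'
      exact_mod_cast hnd'
    have hθeq : θ = χ₁ := by rw [hθχ, hn1]; simp
    have hχ₁one : χ₁ 1 = 1 := by rw [hd1, hd1']; simp
    obtain ⟨θ₁, hθ₁⟩ := exists_monoidHom_of_isCharacter_apply_one hχ₁.isCharacter hχ₁one
    exact ⟨θ₁, by rw [hθeq]; funext g; exact hθ₁ g⟩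

end Structure

/-! ### The fixed field of `q⁻¹(ker χ₁)` is an abelian extension of `ℚ` -/

section Abelian

variable {G : Type} [Group G] [Fintype G] {q : Field.absoluteGaloisGroup ℚ →* G}

/-- For a finite Galois quotient `q : Γ_ℚ → G` and a character of degree one `χ₁ : G →* ℂˣ`, the fixed
field `k₁ = ℚ̄^{q⁻¹(ker χ₁)}` is Galois over `ℚ` with commutative group (`Gal(k₁/ℚ) ≅ Γ_ℚ / ker(χ₁ ∘ q) ↪ ℂˣ`;
infinite Galois correspondence for the closed = open subgroup `q⁻¹(ker χ₁)`). -/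
theorem isAbelianGalois_quotientFixedField_ker (hq : IsArtinQuotient q) (χ₁ : G →* ℂˣ) :
    IsAbelianGalois ℚ (quotientFixedField q χ₁.ker) := by
  set k₁ : IntermediateField ℚ (AlgebraicClosure ℚ) := quotientFixedField q χ₁.ker with hk₁
  have hH : (χ₁.ker.comap q) = (χ₁.comp q).ker := MonoidHom.comap_ker χ₁ q
  have hopen : IsOpen ((χ₁.ker.comap q : Subgroup (Field.absoluteGaloisGroup ℚ)) :
      Set (Field.absoluteGaloisGroup ℚ)) := hq.isOpen_comap _
  have hclosed : IsClosed ((χ₁.ker.comap q : Subgroup (Field.absoluteGaloisGroup ℚ)) :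
      Set (Field.absoluteGaloisGroup ℚ)) := Subgroup.isClosed_of_isOpen _ hopen
  let Hc : ClosedSubgroup (Field.absoluteGaloisGroup ℚ) := ⟨χ₁.ker.comap q, hclosed⟩
  have hfix : k₁.fixingSubgroup = χ₁.ker.comap q := InfiniteGalois.fixingSubgroup_fixedField Hc
  have hnormal : k₁.fixingSubgroup.Normal := by
    rw [hfix, hH]
    exact MonoidHom.normal_ker _
  haveI hgal : IsGalois ℚ k₁ := (InfiniteGalois.normal_iff_isGalois k₁).mp hnormal
  have hcomm : ∀ a b : k₁ ≃ₐ[ℚ] k₁, a * b = b * a := by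
    intro a b
    -- the restriction `Γ_ℚ → Gal(k₁/ℚ)`, typed on `Field.absoluteGaloisGroup ℚ` (same carrier as `q`)
    let r : Field.absoluteGaloisGroup ℚ →* (k₁ ≃ₐ[ℚ] k₁) := AlgEquiv.restrictNormalHom k₁
    have hrsurj : Function.Surjective r :=
      AlgEquiv.restrictNormalHom_surjective (AlgebraicClosure ℚ)
    have hle' : (χ₁.ker.comap q) ≤ k₁.fixingSubgroup :=
      (IntermediateField.le_iff_le (χ₁.ker.comap q) k₁).mp le_rfl
    have hrker : ∀ x : Field.absoluteGaloisGroup ℚ, χ₁ (q x) = 1 → r x = 1 := by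
      intro x hx
      have hx' : x ∈ χ₁.ker.comap q := Subgroup.mem_comap.mpr (MonoidHom.mem_ker.mpr hx)
      have hx'' : x ∈ k₁.fixingSubgroup := hle' hx'
      have hx''' : x ∈ (AlgEquiv.restrictNormalHom (F := ℚ) (K₁ := AlgebraicClosure ℚ) k₁).ker :=
        (IntermediateField.restrictNormalHom_ker k₁).ge hx''
      exact MonoidHom.mem_ker.mp hx'''
    obtain ⟨γ, rfl⟩ := hrsurj a
    obtain ⟨δ, rfl⟩ := hrsurj b
    have h1 : r (γ * δ * γ⁻¹ * δ⁻¹) = 1 := by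
      apply hrker
      rw [map_mul, map_mul, map_mul, map_inv, map_inv, map_mul, map_mul, map_mul, map_inv, map_inv,
        mul_comm (χ₁ (q γ)) (χ₁ (q δ))]
      group
    rw [map_mul, map_mul, map_mul, map_inv, map_inv] at h1
    calc r γ * r δ = r γ * r δ * (r γ)⁻¹ * (r δ)⁻¹ * (r δ * r γ) := by group
      _ = r δ * r γ := by rw [h1, one_mul]
  haveI : IsMulCommutative (k₁ ≃ₐ[ℚ] k₁) := ⟨⟨hcomm⟩⟩
  exact {}

end Abelian

/-! ### The Stark seam: ERH ⟸ AbelianERH ∧ GaloisMultipleZerosOnLine -/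

/-- **The Stark seam** (sorry-free; concludes the Literature constant, `=` the route decl by `rfl`, so that the
registered composition below is the unique theorem concluding the crux by name): ERH for every number field from
ERH for ABELIAN fields and the
multiple-zero statement for GALOIS fields. Given a strip zero `s` of `ζ_K`: normal closure `N₀` of `K` in `ℚ̄`,
Artin quotient `q : Γ_ℚ → Gal(N₀/ℚ)`; `ord_s ζ_{N₀} ≥ 2` ⇒ X₂ on `N₀`; `ord_s ζ_{N₀} ≤ 1` ⇒ Heilbronn–Stark
(`Σ_χ n(G,χ)² ≤ (ord_s ζ_{N₀})²`, tree `sum_sq_artinOrder_le`) makes `θ_G` a LINEAR character `χ₁`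
(`heilbronnChar_eq_zero_or_eq_linear`, Stark 1974 Thm. 3 at a complex point), the subfield criterion moves the
zero to `k₁ = ℚ̄^{q⁻¹(ker χ₁)}`, abelian over `ℚ`, and X₁ applies. [cite: Stark1974, Thm. 3] [cite: MurtyMurty1997, Ch. 2 §5–6] -/
theorem erh_of_abelianERH (h₁ : AbelianERH) (h₂ : GaloisMultipleZerosOnLine) :
    Literature.NumberTheory.LFunctions.ExtendedRiemannHypothesis := by
  intro K _ _ s h0 hpos hlt
  classical
  have hs1 : s ≠ 1 := by
    intro h
    rw [h, one_re] at hlt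
    exact lt_irrefl _ hlt
  -- the normal closure `N₀` of `K` inside `ℚ̄`, an embedded copy `E = f(K)`, `q : Γ_ℚ → Gal(N₀/ℚ)`
  let L := AlgebraicClosure ℚ
  let N₀ : IntermediateField ℚ L := normalClosure ℚ K L
  let f : K →ₐ[ℚ] L := IsAlgClosed.lift
  have hE : f.fieldRange ≤ N₀ := f.fieldRange_le_normalClosure
  obtain ⟨q, hq⟩ : ∃ q : Field.absoluteGaloisGroup ℚ →* (N₀ ≃ₐ[ℚ] N₀),
      q = AlgEquiv.restrictNormalHom N₀ := ⟨_, rfl⟩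
  have hqA : IsArtinQuotient q := isArtinQuotient_of_eq_restrictNormalHom hq
  haveI hNF : ∀ H', NumberField (quotientFixedField q H') :=
    fun H' => numberField_quotientFixedField hqA H'
  set H : Subgroup (N₀ ≃ₐ[ℚ] N₀) := (f.fieldRange.fixingSubgroup).map q
  have hHE : quotientFixedField q H = f.fieldRange := quotientFixedField_map_fixingSubgroup hq hE
  have hbot : quotientFixedField q ⊥ = N₀ := quotientFixedField_bot_of_eq_restrictNormalHom hq
  haveI hN₀gal : IsGalois ℚ N₀ :=
    { to_isSeparable := Algebra.isSeparable_tower_bot_of_isSeparable ℚ N₀ L }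
  haveI : NumberField N₀ := NumberField.of_module_finite ℚ N₀
  have eK : K ≃ₐ[ℚ] f.fieldRange := f.equivFieldRange
  -- `ζ_{F_H}(s) = ζ_K(s) = 0`
  have e1 : quotientFixedField q H ≃+* K :=
    ((IntermediateField.equivOfEq hHE).trans eK.symm).toRingEquiv
  have hH0 : dedekindZetaCont (quotientFixedField q H) s = 0 := by
    rw [dedekindZetaCont_eq_of_ringEquiv e1 hs1]
    exact h0
  have e3 : quotientFixedField q (⊥ : Subgroup (N₀ ≃ₐ[ℚ] N₀)) ≃+* N₀ :=
    (IntermediateField.equivOfEq hbot).toRingEquiv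
  by_cases hle : artinOrder s ((Representation.leftRegular ℂ (N₀ ≃ₐ[ℚ] N₀)).character ∘ q) ≤ 1
  · -- `ord_s ζ_{N₀} ≤ 1`: Heilbronn–Stark, the zero is carried by an abelian subfield
    rcases heilbronnChar_eq_zero_or_eq_linear hqA hs1 hle with hθ | ⟨χ₁, hθ⟩
    · exact absurd hH0 (dedekindZetaCont_quotientFixedField_ne_zero_of_eq_zero hqA hs1 hθ H)
    · have hk0 : dedekindZetaCont (quotientFixedField q χ₁.ker) s = 0 :=
        (dedekindZetaCont_quotientFixedField_eq_zero_iff hqA hs1 hθ χ₁.ker).mpr le_rfl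
      have hab : IsAbelianGalois ℚ (quotientFixedField q χ₁.ker) :=
        isAbelianGalois_quotientFixedField_ker hqA χ₁
      haveI : @IsAbelianGalois ℚ (quotientFixedField q χ₁.ker) _ _ DivisionRing.toRatAlgebra :=
        isAbelianGalois_transport _ _ hab
      exact h₁ (quotientFixedField q χ₁.ker) s hk0 hpos hlt
  · -- `ord_s ζ_{N₀} ≥ 2`: a multiple zero of the Galois field `N₀`
    have h2 : ((2 : ℤ) : WithTop ℤ) ≤ meromorphicOrderAt (dedekindZetaCont N₀) s := by
      have h1 := artinOrder_leftRegular hqA s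
      rw [meromorphicOrderAt_dedekindZetaCont_eq_of_ringEquiv e3 hs1] at h1
      rw [← h1]
      have h2' : (2 : ℤ) ≤ artinOrder s
          ((Representation.leftRegular ℂ (N₀ ≃ₐ[ℚ] N₀)).character ∘ q) := by omega
      exact_mod_cast h2'
    obtain ⟨hz, hd⟩ := eq_zero_and_deriv_eq_zero_of_two_le (analyticAt_dedekindZetaCont hs1) h2
    haveI : @IsGalois ℚ _ N₀ _ DivisionRing.toRatAlgebra := isGalois_transport _ _ hN₀gal
    exact h₂ N₀ s hpos hlt hz hd

/-! ### The registered composition -/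

/-- **COMPOSITION** (kernel-checked, sorry-free): ERH from the four leaf statements (stated on the Literature
constant, which IS the route decl `GaloisWeightedBE.ExtendedRiemannHypothesis` by `rfl`; the registered form below
carries the route name, so that exactly one theorem concludes the crux by name for the skeleton audit). [folklore] -/
theorem ExtendedRiemannHypothesis_of :
    RiemannHypothesis →
    (∀ (N : ℕ) [NeZero N] (χ : DirichletCharacter ℂ N), χ.IsPrimitive → χ ≠ 1 → χ.RiemannHypothesis) →
    (∀ (G : Type) [Group G] [Fintype G] (q : Field.absoluteGaloisGroup ℚ →* G), IsArtinQuotient q →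
      ∀ (s : ℂ), 0 < s.re → s.re < 1 → s.re ≠ 1 / 2 →
      ∀ χ : G → ℂ, IsIrrChar G χ → χ 1 ≠ 1 → artinOrder s (χ ∘ q) = 0) →
    (∀ (G : Type) [Group G] [Fintype G] (q : Field.absoluteGaloisGroup ℚ →* G), IsArtinQuotient q →
      ∀ (s : ℂ), 0 < s.re → s.re < 1 → s.re ≠ 1 / 2 →
      (∑ χ ∈ (irrChars_finite_holds G).toFinset with χ 1 = 1, artinOrder s (χ ∘ q)) ≤ 1) →
    Literature.NumberTheory.LFunctions.ExtendedRiemannHypothesis :=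
  fun h₁ h₂ h₃ h₄ => erh_of_abelianERH
    (abelianERH_of_generalizedRiemannHypothesis (generalizedRiemannHypothesis_of h₁ h₂))
    (GaloisMultipleZerosOnLine_of h₃ h₄)

/-- **Registered (closed) form**: the crux `GaloisWeightedBE.ExtendedRiemannHypothesis` (route decl, BY NAME) from
the four registered stubs through the sorry-free composition `ExtendedRiemannHypothesis_of`. [folklore] -/
theorem ExtendedRiemannHypothesis_from_stubs :
    Summit.Langlands.Langlands.Theses.GaloisWeightedBE.ExtendedRiemannHypothesis :=
  ExtendedRiemannHypothesis_of stub_riemannHypothesis stub_grhNonprincipalPrimitive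
    stub_nonlinearArtinOrderZero stub_linearArtinOrderSumLeOne

end Summit.Langlands.Langlands.Cruxes.ExtendedRiemannHypothesis.ArtinSplitLine

end
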